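import Summits.CriticalPhenomena.PercolationContinuityZ3.Theorems.Transplant.FKConnectivityAllQPat3KNetBridge
import HarnessLib

/-!
# Connectivity correlation inequalities for `φ_{w,q}`, every `q > 0` — THEOREM SP(𝒦): the reduction steps of the K-state leaves

Helper file (`--supports stmt-CriticalPhenomena-4575`), census lineage (gen 41) of LANE 2's FK sub-programme; builds on p205010 (kernel
theorem, internal audit signed; external expert review pending).  No definitions, no named facts, no sorries; standard axioms.

The two generic steps by which every K-state LEAF of THEOREM SP(𝒦) (census g41 drafts/README, the 12 specs of «…KNetSPLeavesI») reduces
its mark-free 𝒦-slots to plain edges, given the OUTER induction hypothesis `ihSP` (THEOREM SP on 𝒦-networks with fewer edges than `N₀`):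
* **doubling** — `FK.SPGoodC.of_sdiff`: plain slots lying in `E ∩ C` may be removed from `E` (through the weight form,
  «Pat3KNetBridge» `FK.mval2C_nonneg_of_sdiff`);
* **shrinking** — `FK.spGoodC_of_shrink`: if a mark-free 𝒦-slot `Q` (between `u, v`, touching the rest `R` inside `{u, v}`) has at least
  two edges, `SPGoodC` on every minor of `R ∪ Q` follows from `ihSP` on the strictly smaller 𝒦-network `R ∪ {uv}` through
  «Pat3KNetBridge» `FK.oneSided_of_shrunk`, one target table at a time;
* **erasing** — `FK.spGoodC_of_erase`: a plain slot outside `E ∪ C` is deleted (`ihSP` on `N ∖ e`).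
[cite: AyyerLinussonRavichandran2025, §7 (p. 22)]
-/

namespace Summit.CriticalPhenomena.PercolationContinuityZ3.Theorems

namespace FK

open scoped Classical

variable {V : Type*}

section Doubling

variable [Fintype V]

omit [Fintype V] in
/-- **Doubling away plain slots of `E ∩ C`, levelwise**: `SPGoodC (E ∖ D) C` for `D ⊆ C` gives `SPGoodC E C` — through the
weight form («Pat3KNetBridge» `FK.mval2C_nonneg_of_sdiff`, `FK.mval2C_nonneg_of_lev2C`, `FK.lev2C_nonneg_of_mval2C`). [folklore] -/
theorem SPGoodC.of_sdiff {E C D : Finset (Sym2 V)} (hD : D ⊆ C) {b s t : V} (h : SPGoodC (E \ D) C b s t) : SPGoodC E C b s t :=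
  fun μ =>
  ⟨lev2C_nonneg_of_mval2C (fun w hw => mval2C_nonneg_of_sdiff w hD b s t tsym2Tab (mval2C_nonneg_of_lev2C (fun ν => (h ν).1) hw)) μ,
    lev2C_nonneg_of_mval2C (fun w hw => mval2C_nonneg_of_sdiff w hD b s t starXTab (mval2C_nonneg_of_lev2C (fun ν => (h ν).2.1) hw)) μ,
    lev2C_nonneg_of_mval2C
      (fun w hw => mval2C_nonneg_of_sdiff w hD b s t (mirror2 starXTab) (mval2C_nonneg_of_lev2C (fun ν => (h ν).2.2.1) hw)) μ,
    lev2C_nonneg_of_mval2C (fun w hw => mval2C_nonneg_of_sdiff w hD b s t starSTab (mval2C_nonneg_of_lev2C (fun ν => (h ν).2.2.2) hw)) μ⟩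

end Doubling

section Shrink

variable [Fintype V] {N₀ : Finset (Sym2 V)}

/-- **SHRINKING A MARK-FREE 𝒦-SLOT** (census g41): `N = R ∪ Q`, `Q` a 𝒦-network between `u, v` with at least two edges, meeting `R`
inside `{u, v}`, the three marks off the interior of `Q`; if `R ∪ {uv}` is a 𝒦-network (between any poles) inside the reach of the outer
induction hypothesis `ihSP` (fewer edges than `N₀ ⊇ N`), then every minor of `N` is SP-good at the marks — by «Pat3KNetBridge»
`FK.oneSided_of_shrunk`, table by table. [cite: AyyerLinussonRavichandran2025, §7 (p. 22)] -/
theorem spGoodC_of_shrink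
    (ihSP : ∀ {N' E' C' : Finset (Sym2 V)} {x' y' b' s' t' : V}, N'.card < N₀.card → IsKNet N' x' y' → E' ⊆ N' → C' ⊆ N' →
      (∃ e ∈ N', b' ∈ e) → (∃ e ∈ N', s' ∈ e) → (∃ e ∈ N', t' ∈ e) → b' ≠ s' → b' ≠ t' → s' ≠ t' → SPGoodC E' C' b' s' t')
    {R Q : Finset (Sym2 V)} {u v x' y' b s t : V} (hdRQ : Disjoint R Q)
    (hRQ : ∀ w : V, (∃ e ∈ R, w ∈ e) → (∃ e ∈ Q, w ∈ e) → w = u ∨ w = v) (hQ : IsKNet Q u v) (h2 : 2 ≤ Q.card)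
    (heR : s(u, v) ∉ R) (hN' : IsKNet (R ∪ {s(u, v)}) x' y') (hN : R ∪ Q ⊆ N₀)
    (hb : ∃ e ∈ R ∪ Q, b ∈ e) (hs : ∃ e ∈ R ∪ Q, s ∈ e) (ht : ∃ e ∈ R ∪ Q, t ∈ e)
    (hbQ : (∃ e ∈ Q, b ∈ e) → b = u ∨ b = v) (hsQ : (∃ e ∈ Q, s ∈ e) → s = u ∨ s = v) (htQ : (∃ e ∈ Q, t ∈ e) → t = u ∨ t = v)
    (hbs : b ≠ s) (hbt : b ≠ t) (hst : s ≠ t)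
    {E C : Finset (Sym2 V)} (hE : E ⊆ R ∪ Q) (hC : C ⊆ R ∪ Q) : SPGoodC E C b s t := by
  have huv : u ≠ v := hQ.ne
  -- the shrunk network is strictly smaller than `N₀`
  have hlt : (R ∪ {s(u, v)}).card < N₀.card := by
    have h1 : (R ∪ {s(u, v)}).card ≤ R.card + 1 := (Finset.card_union_le _ _).trans (by simp)
    have h2 : (R ∪ Q).card = R.card + Q.card := Finset.card_union_of_disjoint hdRQ
    have h3 := Finset.card_le_card hN
    omega
  -- marks transfer to the shrunk network
  have tr : ∀ {m : V}, (∃ e ∈ R ∪ Q, m ∈ e) → ((∃ e ∈ Q, m ∈ e) → m = u ∨ m = v) → ∃ e ∈ R ∪ {s(u, v)}, m ∈ e := by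
    rintro m ⟨e, he, hme⟩ hmQ
    rcases Finset.mem_union.1 he with he | he
    · exact ⟨e, Finset.mem_union_left _ he, hme⟩
    · rcases hmQ ⟨e, he, hme⟩ with rfl | rfl
      · exact ⟨_, Finset.mem_union_right _ (Finset.mem_singleton_self _), Sym2.mem_mk_left _ _⟩
      · exact ⟨_, Finset.mem_union_right _ (Finset.mem_singleton_self _), Sym2.mem_mk_right _ _⟩
  have hb' := tr hb hbQ
  have hs' := tr hs hsQ
  have ht' := tr ht htQ
  have good : ∀ E' C' : Finset (Sym2 V), E' ⊆ R ∪ {s(u, v)} → C' ⊆ R ∪ {s(u, v)} → SPGoodC E' C' b s t :=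
    fun E' C' hE' hC' => ihSP hlt hN' hE' hC' hb' hs' ht' hbs hbt hst
  intro μ
  refine ⟨?_, ?_, ?_, ?_⟩
  · exact oneSided_of_shrunk hdRQ hRQ huv heR hbQ hsQ htQ tsym2Tab (fun E' C' hE' hC' ν => (good E' C' hE' hC' ν).1) hE hC μ
  · exact oneSided_of_shrunk hdRQ hRQ huv heR hbQ hsQ htQ starXTab (fun E' C' hE' hC' ν => (good E' C' hE' hC' ν).2.1) hE hC μ
  · exact oneSided_of_shrunk hdRQ hRQ huv heR hbQ hsQ htQ (mirror2 starXTab)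
      (fun E' C' hE' hC' ν => (good E' C' hE' hC' ν).2.2.1) hE hC μ
  · exact oneSided_of_shrunk hdRQ hRQ huv heR hbQ hsQ htQ starSTab (fun E' C' hE' hC' ν => (good E' C' hE' hC' ν).2.2.2) hE hC μ

omit [Fintype V] in
/-- **ERASING A PLAIN SLOT OUTSIDE `E ∪ C`** (census g41): if `e ∈ N` lies in neither `E` nor `C` and `N ∖ e = M` is a 𝒦-network
carrying the marks, the outer induction hypothesis (below `N₀ ⊇ N`) gives `SPGoodC E C` directly. [cite: AyyerLinussonRavichandran2025, §7 (p. 22)] -/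
theorem spGoodC_of_erase
    (ihSP : ∀ {N' E' C' : Finset (Sym2 V)} {x' y' b' s' t' : V}, N'.card < N₀.card → IsKNet N' x' y' → E' ⊆ N' → C' ⊆ N' →
      (∃ e ∈ N', b' ∈ e) → (∃ e ∈ N', s' ∈ e) → (∃ e ∈ N', t' ∈ e) → b' ≠ s' → b' ≠ t' → s' ≠ t' → SPGoodC E' C' b' s' t')
    {N M : Finset (Sym2 V)} {e : Sym2 V} {x' y' b s t : V} (heN : e ∈ N) (heM : e ∉ M) (hMN : M ⊆ N) (hNM : N ⊆ insert e M)
    (hMK : IsKNet M x' y') (hN : N ⊆ N₀) (hb : ∃ f ∈ M, b ∈ f) (hs : ∃ f ∈ M, s ∈ f) (ht : ∃ f ∈ M, t ∈ f)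
    (hbs : b ≠ s) (hbt : b ≠ t) (hst : s ≠ t)
    {E C : Finset (Sym2 V)} (hE : E ⊆ N) (hC : C ⊆ N) (heE : e ∉ E) (heC : e ∉ C) : SPGoodC E C b s t :=
  have hlt : M.card < N₀.card :=
    lt_of_lt_of_le (Finset.card_lt_card ⟨hMN, fun h => heM (h heN)⟩) (Finset.card_le_card hN)
  ihSP hlt hMK ((Finset.subset_insert_iff_of_notMem heE).1 (hE.trans hNM))
    ((Finset.subset_insert_iff_of_notMem heC).1 (hC.trans hNM)) hb hs ht hbs hbt hst

end Shrink

end FK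

end Summit.CriticalPhenomena.PercolationContinuityZ3.Theorems
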